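import Summits.Parity.GeneralizedHardyLittlewood.Theorems.ChenParityOracleBLAPHostParityFromBrickBoxes
import Literature.NumberTheory.Sieve.ChenSwitchedRemainder
import HarnessLib

/-!
# Route `ChenParityOracleBLAP` — crux S1 = `HostParityFromBrick` (stmt-Parity-20045): the Type-II boxes of the switched host

Support file for the switched half `K1 → K2 → HP2` of S1.  The sorted prime triples
`(p₁, p₂, p₃)` of Chen's switched host `B(x) = {p₁p₂p₃ − 2}` are classified by the `ρ`-adic
indices `(⌊log p₁/log ρ⌋, ⌊log p₂/log ρ⌋, ⌊log p₃/log ρ⌋) = (k, i, j)`; for a GOOD class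
(`i < j` and `ρ^{k+i+j+3} ≤ x + 2`) the cross-conditions `p₂ ≤ p₃`, `p₁p₂p₃ ≤ x + 2` are automatic,
so the class is the product `P₁(k) × P₂(i) × P₃(j)` of three sets of primes
(`filter_index_eq_product`), and its oracle congruence sum is LITERALLY a K-box sum
`∑_{m ∼ M} ∑_{n ∼ N, d ∣ mn−2} α_m β_n λ(mn−2)` with `m = p₂`, `n = p₁p₃`, `α = 1_{P₂(i)}`,
`β(n) = #{(p₁,p₃) ∈ P₁(k) × P₃(j) : p₁p₃ = n} ≤ 1`, `M = ⌈ρ^i⌉ − 1`, `N = ⌈ρ^{k+j}⌉ − 1`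
(`sum_index_class_eq_box`).  With the brick-on-a-box inequality
(`brick_box_sum_le`, file `…HostParityFromBrickBoxes`) this bounds every good class
(`sum_abs_index_class_le`).

References: Chen Jing-run, Sci. Sinica 16 (1973) [ChenSciSinica1973]; M. B. Nathanson, *Additive
Number Theory: The Classical Bases* (1996), §10.2 and (10.13) (the grid on `p₁`) [Nathanson1996];
G. Harman, *Prime-Detecting Sieves* (2007), Ch. 3 [Harman2007].
-/

namespace Summit.Parity.GeneralizedHardyLittlewood.Theorems

open Finset Real
open Literature.NumberTheory.Sieve.Chen

/-! ### `ρ`-adic indices -/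

/-- `ρ^{⌊log p / log ρ⌋} ≤ p` for `p ≥ 1`, `ρ > 1`. -/
theorem rho_pow_floor_le {ρ : ℝ} (hρ : 1 < ρ) {p : ℕ} (hp : 1 ≤ p) :
    ρ ^ ⌊Real.log p / Real.log ρ⌋₊ ≤ (p : ℝ) := by
  have hlρ : 0 < Real.log ρ := Real.log_pos hρ
  have hp0 : (0 : ℝ) < p := by exact_mod_cast hp
  have hlp : 0 ≤ Real.log p := Real.log_nonneg (by exact_mod_cast hp)
  have h1 : (⌊Real.log p / Real.log ρ⌋₊ : ℝ) ≤ Real.log p / Real.log ρ :=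
    Nat.floor_le (div_nonneg hlp hlρ.le)
  have h2 : (⌊Real.log p / Real.log ρ⌋₊ : ℝ) * Real.log ρ ≤ Real.log p := by
    rwa [le_div_iff₀ hlρ] at h1
  calc ρ ^ ⌊Real.log p / Real.log ρ⌋₊
      = Real.exp ((⌊Real.log p / Real.log ρ⌋₊ : ℝ) * Real.log ρ) := by
        rw [← Real.rpow_natCast, Real.rpow_def_of_pos (by linarith), mul_comm]
    _ ≤ Real.exp (Real.log p) := Real.exp_le_exp.mpr h2
    _ = p := Real.exp_log hp0

/-- `p < ρ^{⌊log p / log ρ⌋ + 1}` for `ρ > 1`. -/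
theorem lt_rho_pow_floor_succ {ρ : ℝ} (hρ : 1 < ρ) (p : ℕ) :
    (p : ℝ) < ρ ^ (⌊Real.log p / Real.log ρ⌋₊ + 1) := by
  have hlρ : 0 < Real.log ρ := Real.log_pos hρ
  rcases Nat.eq_zero_or_pos p with hp | hp
  · subst hp; simp only [Nat.cast_zero]; positivity
  have hp0 : (0 : ℝ) < p := by exact_mod_cast hp
  have h1 : Real.log p / Real.log ρ < (⌊Real.log p / Real.log ρ⌋₊ : ℝ) + 1 := Nat.lt_floor_add_one _
  have h2 : Real.log p < ((⌊Real.log p / Real.log ρ⌋₊ : ℝ) + 1) * Real.log ρ := by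
    rwa [div_lt_iff₀ hlρ] at h1
  calc (p : ℝ) = Real.exp (Real.log p) := (Real.exp_log hp0).symm
    _ < Real.exp (((⌊Real.log p / Real.log ρ⌋₊ : ℝ) + 1) * Real.log ρ) := Real.exp_lt_exp.mpr h2
    _ = ρ ^ (⌊Real.log p / Real.log ρ⌋₊ + 1) := by
        rw [← Real.rpow_natCast, Real.rpow_def_of_pos (by linarith), mul_comm]
        push_cast; ring_nf

/-- The index is monotone: `p ≤ q ⇒ ⌊log p/log ρ⌋ ≤ ⌊log q/log ρ⌋` (`ρ > 1`). -/
theorem floor_log_div_mono {ρ : ℝ} (hρ : 1 < ρ) {p q : ℕ} (h : p ≤ q) :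
    ⌊Real.log p / Real.log ρ⌋₊ ≤ ⌊Real.log q / Real.log ρ⌋₊ := by
  have hlρ : 0 < Real.log ρ := Real.log_pos hρ
  rcases Nat.eq_zero_or_pos p with hp | hp
  · subst hp; simp
  refine Nat.floor_mono (div_le_div_of_nonneg_right ?_ hlρ.le)
  exact Real.log_le_log (by exact_mod_cast hp) (by exact_mod_cast h)

/-! ### Box sums with indicator / fibre-counting coefficients -/

/-- **Unfolding a K-box sum with `α = 1_{P}` and `β = ` fibre count of `q ↦ q₁q₂`**: for
`P ⊆ (M, 2M]` and a set of pairs `Q` whose products lie in `(N, 2N]`,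
`∑_{m ∼ M} ∑_{n ∼ N} 1_P(m) · #{q ∈ Q : q₁q₂ = n} · G(m, n) = ∑_{m ∈ P} ∑_{q ∈ Q} G(m, q₁q₂)`. -/
theorem box_sum_indicator_fibre {M N : ℕ} {P : Finset ℕ} (hP : P ⊆ Finset.Ioc M (2 * M))
    {Q : Finset (ℕ × ℕ)} (hQ : ∀ q ∈ Q, q.1 * q.2 ∈ Finset.Ioc N (2 * N)) (G : ℕ → ℕ → ℝ) :
    ∑ m ∈ Finset.Ioc M (2 * M), ∑ n ∈ Finset.Ioc N (2 * N),
      (if m ∈ P then (1 : ℝ) else 0) * (#(Q.filter (fun q => q.1 * q.2 = n)) : ℝ) * G m n =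
      ∑ m ∈ P, ∑ q ∈ Q, G m (q.1 * q.2) := by
  classical
  -- the `m`-sum
  have hm : ∀ F : ℕ → ℝ, ∑ m ∈ Finset.Ioc M (2 * M), (if m ∈ P then (1 : ℝ) else 0) * F m =
      ∑ m ∈ P, F m := by
    intro F
    rw [← Finset.sum_filter_add_sum_filter_not (Finset.Ioc M (2 * M)) (fun m => m ∈ P)]
    have h1 : (Finset.Ioc M (2 * M)).filter (fun m => m ∈ P) = P := by
      ext m; simp only [Finset.mem_filter]; exact ⟨fun h => h.2, fun h => ⟨hP h, h⟩⟩
    rw [h1, Finset.sum_eq_zero (s := (Finset.Ioc M (2 * M)).filter (fun m => m ∉ P)), add_zero]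
    · exact Finset.sum_congr rfl fun m hmP => by rw [if_pos hmP, one_mul]
    · intro m hm'
      rw [Finset.mem_filter] at hm'
      rw [if_neg hm'.2, zero_mul]
  -- the `n`-sum
  have hn : ∀ F : ℕ → ℝ, ∑ n ∈ Finset.Ioc N (2 * N), (#(Q.filter (fun q => q.1 * q.2 = n)) : ℝ) * F n =
      ∑ q ∈ Q, F (q.1 * q.2) := by
    intro F
    have h1 : ∀ n, (#(Q.filter (fun q => q.1 * q.2 = n)) : ℝ) * F n =
        ∑ q ∈ Q, (if q.1 * q.2 = n then F n else 0) := by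
      intro n
      rw [Finset.card_filter, Nat.cast_sum, Finset.sum_mul]
      refine Finset.sum_congr rfl fun q _ => ?_
      split_ifs <;> simp
    simp_rw [h1]
    rw [Finset.sum_comm]
    refine Finset.sum_congr rfl fun q hq => ?_
    rw [Finset.sum_ite_eq (Finset.Ioc N (2 * N)) (q.1 * q.2) (fun n => F n)]
    simp only [if_pos (hQ q hq)]
  calc ∑ m ∈ Finset.Ioc M (2 * M), ∑ n ∈ Finset.Ioc N (2 * N),
        (if m ∈ P then (1 : ℝ) else 0) * (#(Q.filter (fun q => q.1 * q.2 = n)) : ℝ) * G m n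
      = ∑ m ∈ Finset.Ioc M (2 * M), (if m ∈ P then (1 : ℝ) else 0) *
          ∑ n ∈ Finset.Ioc N (2 * N), (#(Q.filter (fun q => q.1 * q.2 = n)) : ℝ) * G m n := by
        refine Finset.sum_congr rfl fun m _ => ?_
        rw [Finset.mul_sum]
        refine Finset.sum_congr rfl fun n _ => by ring
    _ = ∑ m ∈ P, ∑ n ∈ Finset.Ioc N (2 * N), (#(Q.filter (fun q => q.1 * q.2 = n)) : ℝ) * G m n :=
        hm _
    _ = ∑ m ∈ P, ∑ q ∈ Q, G m (q.1 * q.2) := Finset.sum_congr rfl fun m _ => hn (G m)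

/-- Re-indexing a sum over a product of three sets by the middle variable:
`∑_{(p₁,p₂,p₃) ∈ P₁×P₂×P₃} F(p₁p₂p₃) = ∑_{p₂ ∈ P₂} ∑_{(p₁,p₃) ∈ P₁×P₃} F(p₂ · (p₁p₃))`. -/
theorem sum_product3_middle (P₁ P₂ P₃ : Finset ℕ) (F : ℕ → ℝ) :
    ∑ t ∈ P₁ ×ˢ (P₂ ×ˢ P₃), F (t.1 * t.2.1 * t.2.2) =
      ∑ m ∈ P₂, ∑ q ∈ P₁ ×ˢ P₃, F (m * (q.1 * q.2)) := by
  rw [Finset.sum_product]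
  simp_rw [Finset.sum_product (s := P₂) (t := P₃), Finset.sum_product (s := P₁) (t := P₃)]
  rw [Finset.sum_comm]
  refine Finset.sum_congr rfl fun b _ => Finset.sum_congr rfl fun a _ =>
    Finset.sum_congr rfl fun c _ => ?_
  ring_nf


/-! ### Good index classes are products -/

/-- **A good index class is a product.**  For `ρ > 1`, `i < j` and `ρ^{k+i+j+3} ≤ x + 2`, the
sorted prime triples `(p₁, p₂, p₃)` of `B(x)` (`x^{1/8} ≤ p₁ < y ≤ p₂ ≤ p₃`, `p₁p₂p₃ ≤ x + 2`)
with `ρ`-adic indices `(k, i, j)` are exactly the triples of `P₁(k) × P₂(i) × P₃(j)`: the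
cross-conditions `p₂ ≤ p₃` and `p₁p₂p₃ ≤ x + 2` follow from the indices. -/
theorem filter_index_eq_product {x : ℕ} {ρ : ℝ} (hρ : 1 < ρ) {k i j : ℕ} (hij : i < j)
    (htop : ρ ^ (k + i + j + 3) ≤ (x : ℝ) + 2) :
    ((Finset.range (x + 3) ×ˢ Finset.range (x + 3) ×ˢ Finset.range (x + 3)).filter
        (fun t : ℕ × ℕ × ℕ => t.1.Prime ∧ t.2.1.Prime ∧ t.2.2.Prime ∧ twinZ x ≤ t.1 ∧ t.1 < twinY x ∧
          twinY x ≤ t.2.1 ∧ t.2.1 ≤ t.2.2 ∧ t.1 * t.2.1 * t.2.2 ≤ x + 2)).filter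
      (fun t : ℕ × ℕ × ℕ => ⌊Real.log t.1 / Real.log ρ⌋₊ = k ∧ ⌊Real.log t.2.1 / Real.log ρ⌋₊ = i ∧
        ⌊Real.log t.2.2 / Real.log ρ⌋₊ = j) =
      ((Finset.range (x + 3)).filter (fun p => p.Prime ∧ twinZ x ≤ p ∧ p < twinY x ∧
          ⌊Real.log p / Real.log ρ⌋₊ = k)) ×ˢ
        (((Finset.range (x + 3)).filter (fun p => p.Prime ∧ twinY x ≤ p ∧
            ⌊Real.log p / Real.log ρ⌋₊ = i)) ×ˢ
          ((Finset.range (x + 3)).filter (fun p => p.Prime ∧ twinY x ≤ p ∧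
            ⌊Real.log p / Real.log ρ⌋₊ = j))) := by
  ext ⟨a, b, c⟩
  simp only [Finset.mem_filter, Finset.mem_product, Finset.mem_range]
  constructor
  · rintro ⟨⟨⟨ha, hb, hc⟩, hpa, hpb, hpc, hza, hay, hyb, hbc, -⟩, hk, hi, hj⟩
    exact ⟨⟨ha, hpa, hza, hay, hk⟩, ⟨hb, hpb, hyb, hi⟩, ⟨hc, hpc, hyb.trans hbc, hj⟩⟩
  · rintro ⟨⟨ha, hpa, hza, hay, hk⟩, ⟨hb, hpb, hyb, hi⟩, ⟨hc, hpc, -, hj⟩⟩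
    have hbc : b ≤ c := by
      by_contra h
      push Not at h
      have := floor_log_div_mono hρ h.le
      rw [hi, hj] at this
      omega
    refine ⟨⟨⟨ha, hb, hc⟩, hpa, hpb, hpc, hza, hay, hyb, hbc, ?_⟩, hk, hi, hj⟩
    have h1 := lt_rho_pow_floor_succ hρ a
    have h2 := lt_rho_pow_floor_succ hρ b
    have h3 := lt_rho_pow_floor_succ hρ c
    rw [hk] at h1; rw [hi] at h2; rw [hj] at h3
    have hρ0 : (0 : ℝ) < ρ := by linarith
    have hprod : ((a * b * c : ℕ) : ℝ) < ρ ^ (k + i + j + 3) := by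
      push_cast
      calc (a : ℝ) * b * c < ρ ^ (k + 1) * ρ ^ (i + 1) * ρ ^ (j + 1) := by
            apply mul_lt_mul'' (mul_lt_mul'' h1 h2 (Nat.cast_nonneg _) (Nat.cast_nonneg _)) h3
              (by positivity) (Nat.cast_nonneg _)
        _ = ρ ^ (k + i + j + 3) := by rw [← pow_add, ← pow_add]; ring_nf
    have : ((a * b * c : ℕ) : ℝ) < (x : ℝ) + 2 := hprod.trans_le htop
    exact_mod_cast (by exact_mod_cast this : a * b * c < x + 2).le


/-! ### The oracle congruence sum of a good class is a K-box sum -/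

/-- **A good class as a K-box.**  With `M = ⌈ρ^i⌉ − 1`, `N = ⌈ρ^{k+j}⌉ − 1`, `α = 1_{P₂(i)}`,
`β(n) = #{(p₁, p₃) ∈ P₁(k) × P₃(j) : p₁p₃ = n}` and `h = −2`, the twisted congruence sum
`∑_{(p₁,p₂,p₃) ∈ P₁×P₂×P₃} [d ∣ p₁p₂p₃ − 2] λ(p₁p₂p₃ − 2)` is the K-box sum
`∑_{m ∼ M} ∑_{n ∼ N, d ∣ mn − 2} α(m) β(n) λ(mn − 2)`, provided `P₂(i) ⊆ (M, 2M]`, the products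
`p₁p₃` lie in `(N, 2N]`, and all elements are `≥ 2`. -/
theorem sum_product3_eq_box {P₁ P₂ P₃ : Finset ℕ} {M N : ℕ} (hP₂ : P₂ ⊆ Finset.Ioc M (2 * M))
    (hQ : ∀ q ∈ P₁ ×ˢ P₃, q.1 * q.2 ∈ Finset.Ioc N (2 * N)) (h2 : ∀ m ∈ P₂, 2 ≤ m)
    (h1 : ∀ q ∈ P₁ ×ˢ P₃, 1 ≤ q.1 * q.2) (d : ℕ) :
    ∑ t ∈ P₁ ×ˢ (P₂ ×ˢ P₃),
        (if d ∣ t.1 * t.2.1 * t.2.2 - 2 then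
          (ArithmeticFunction.liouville (t.1 * t.2.1 * t.2.2 - 2) : ℝ) else 0) =
      ∑ m ∈ Finset.Ioc M (2 * M), ∑ n ∈ (Finset.Ioc N (2 * N)).filter
          (fun n : ℕ => (d : ℤ) ∣ (m : ℤ) * n + (-2)),
        (if m ∈ P₂ then (1 : ℝ) else 0) * (#((P₁ ×ˢ P₃).filter (fun q => q.1 * q.2 = n)) : ℝ) *
          (ArithmeticFunction.liouville (Int.toNat ((m : ℤ) * n + (-2))) : ℝ) := by
  classical
  set G : ℕ → ℕ → ℝ := fun m n => if (d : ℤ) ∣ (m : ℤ) * n + (-2) then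
    (ArithmeticFunction.liouville (Int.toNat ((m : ℤ) * n + (-2))) : ℝ) else 0 with hG
  have hrhs : ∑ m ∈ Finset.Ioc M (2 * M), ∑ n ∈ (Finset.Ioc N (2 * N)).filter
          (fun n : ℕ => (d : ℤ) ∣ (m : ℤ) * n + (-2)),
        (if m ∈ P₂ then (1 : ℝ) else 0) * (#((P₁ ×ˢ P₃).filter (fun q => q.1 * q.2 = n)) : ℝ) *
          (ArithmeticFunction.liouville (Int.toNat ((m : ℤ) * n + (-2))) : ℝ) =
      ∑ m ∈ Finset.Ioc M (2 * M), ∑ n ∈ Finset.Ioc N (2 * N),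
        (if m ∈ P₂ then (1 : ℝ) else 0) * (#((P₁ ×ˢ P₃).filter (fun q => q.1 * q.2 = n)) : ℝ) *
          G m n := by
    refine Finset.sum_congr rfl fun m _ => ?_
    rw [Finset.sum_filter]
    refine Finset.sum_congr rfl fun n _ => ?_
    simp only [hG]
    split_ifs <;> simp
  have hmid := sum_product3_middle P₁ P₂ P₃ (fun v => if d ∣ v - 2 then
    (ArithmeticFunction.liouville (v - 2) : ℝ) else 0)
  rw [hrhs, box_sum_indicator_fibre hP₂ hQ G, hmid]
  refine Finset.sum_congr rfl fun m hm => Finset.sum_congr rfl fun q hq => ?_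
  -- `m (q₁ q₂) − 2` in `ℕ` versus `m (q₁ q₂) + (−2)` in `ℤ`
  have hv : 2 ≤ m * (q.1 * q.2) := by
    have := h2 m hm; have := h1 q hq; nlinarith
  have hint : (m : ℤ) * ((q.1 * q.2 : ℕ) : ℤ) + (-2) = ((m * (q.1 * q.2) - 2 : ℕ) : ℤ) := by
    push_cast [Nat.cast_sub hv]; ring
  simp only [hG, hint, Int.toNat_natCast, Int.natCast_dvd_natCast]

/-! ### The window of a good class -/

/-- **`ρ`-adic intervals sit inside dyadic boxes**: if `2 ≤ ρ^a`, `ρ ≤ 6/5` (`e = 1`) or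
`ρ² ≤ 36/25` (`e = 2`), then every integer `n` with `ρ^a ≤ n < ρ^{a+e}` lies in `(L, 2L]`,
`L = ⌈ρ^a⌉ − 1`; here for `e ≤ 2`. -/
theorem mem_Ioc_of_rho_interval {ρ : ℝ} (hρ : 1 < ρ) (hρ2 : ρ ≤ 6 / 5) {a e : ℕ} (he : e ≤ 2)
    (h2 : (2 : ℝ) ≤ ρ ^ a) {n : ℕ} (hn1 : ρ ^ a ≤ (n : ℝ)) (hn2 : (n : ℝ) < ρ ^ (a + e)) :
    n ∈ Finset.Ioc (⌈ρ ^ a⌉₊ - 1) (2 * (⌈ρ ^ a⌉₊ - 1)) := by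
  set L : ℕ := ⌈ρ ^ a⌉₊ - 1 with hL
  have hρ0 : (0 : ℝ) < ρ := by linarith
  have hLreal : (L : ℝ) = ⌈ρ ^ a⌉₊ - 1 := by
    have h1 : 1 ≤ ⌈ρ ^ a⌉₊ := Nat.one_le_ceil_iff.mpr (by linarith)
    rw [hL, Nat.cast_sub h1, Nat.cast_one]
  have hLlt : (L : ℝ) < ρ ^ a := by
    rw [hLreal]; linarith [Nat.ceil_lt_add_one (show (0 : ℝ) ≤ ρ ^ a by positivity)]
  have hLge : ρ ^ a - 1 ≤ (L : ℝ) := by rw [hLreal]; linarith [Nat.le_ceil (ρ ^ a)]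
  rw [Finset.mem_Ioc]
  constructor
  · exact_mod_cast (show (L : ℝ) < n by linarith)
  · have hρe : ρ ^ e ≤ 36 / 25 := by
      interval_cases e
      · norm_num
      · rw [pow_one]; linarith
      · nlinarith
    have : (n : ℝ) < 2 * L + 1 := by
      calc (n : ℝ) < ρ ^ (a + e) := hn2
        _ = ρ ^ e * ρ ^ a := by rw [pow_add]; ring
        _ ≤ 36 / 25 * (L + 1) := by
            apply mul_le_mul hρe (by linarith) (by positivity) (by norm_num)
        _ ≤ 2 * L + 1 := by nlinarith
    have h' : (n : ℝ) < ((2 * L + 1 : ℕ) : ℝ) := by push_cast; exact this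
    exact Nat.lt_succ_iff.mp (by exact_mod_cast h')

/-- **The window of a good class.**  For `ρ ∈ (1, 6/5]`, `x + 2 ≤ ρ³x`, `x ≥ 2`,
`x^{1/3−δ} ≤ x^{1/3}/ρ − 1`, a class `(k, i, j)` with `i < j`, `8x^{1−δ} < ρ^{k+i+j+3} ≤ x + 2`,
and witnesses `m₀` (`Y ≤ m₀`, `ρ^i ≤ m₀ < ρ^{i+1}`, where `x^{1/3} < Y`, `3 ≤ Y`) and `(a, c)`
(`2 ≤ a < ρ^{k+1}`, `3 ≤ c`, `ρ^j ≤ c`, `ac < ρ^{k+j+2}`): the box `M = ⌈ρ^i⌉ − 1`,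
`N = ⌈ρ^{k+j}⌉ − 1` satisfies `x^{1/3−δ} ≤ M ≤ x^{1/2}`, `x^{1−δ} ≤ MN ≤ x`, and `2 ≤ ρ^i`,
`2 ≤ ρ^{k+j}`. -/
theorem class_window {x : ℕ} (hx2 : 2 ≤ x) {δ ρ : ℝ} (hρ : 1 < ρ) (hρ2 : ρ ≤ 6 / 5)
    (hρx : (x : ℝ) + 2 ≤ ρ ^ 3 * x) (hxδ : (x : ℝ) ^ (1 / 3 - δ) ≤ (x : ℝ) ^ (1 / 3 : ℝ) / ρ - 1)
    {Y : ℝ} (hY3 : 3 ≤ Y) (hYx : (x : ℝ) ^ (1 / 3 : ℝ) < Y)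
    {k i j : ℕ} (hij : i < j) (htop : ρ ^ (k + i + j + 3) ≤ (x : ℝ) + 2)
    (hbot : 8 * (x : ℝ) ^ (1 - δ) < ρ ^ (k + i + j + 3))
    {m₀ : ℝ} (hm₀Y : Y ≤ m₀) (hm₀i : ρ ^ i ≤ m₀) (hm₀i' : m₀ < ρ ^ (i + 1))
    {a c : ℝ} (ha2 : 2 ≤ a) (hak : a < ρ ^ (k + 1)) (hc3 : 3 ≤ c) (hcj : ρ ^ j ≤ c)
    (hcj' : c < ρ ^ (j + 1)) :
    (x : ℝ) ^ (1 / 3 - δ) ≤ ((⌈ρ ^ i⌉₊ - 1 : ℕ) : ℝ) ∧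
      ((⌈ρ ^ i⌉₊ - 1 : ℕ) : ℝ) ≤ (x : ℝ) ^ (1 / 2 : ℝ) ∧
      (x : ℝ) ^ (1 - δ) ≤ ((⌈ρ ^ i⌉₊ - 1 : ℕ) : ℝ) * ((⌈ρ ^ (k + j)⌉₊ - 1 : ℕ) : ℝ) ∧
      ((⌈ρ ^ i⌉₊ - 1 : ℕ) : ℝ) * ((⌈ρ ^ (k + j)⌉₊ - 1 : ℕ) : ℝ) ≤ x ∧
      (2 : ℝ) ≤ ρ ^ i ∧ (2 : ℝ) ≤ ρ ^ (k + j) := by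
  have hρ0 : (0 : ℝ) < ρ := by linarith
  have hx0 : (0 : ℝ) < x := by exact_mod_cast (show 0 < x by omega)
  -- sizes of `ρ^i`, `ρ^{k+j}`
  have hρi : Y / ρ < ρ ^ i := by
    rw [div_lt_iff₀ hρ0, ← pow_succ]; linarith
  have hρi2 : (2 : ℝ) ≤ ρ ^ i := by
    have : Y / ρ ≥ 3 / (6 / 5) := by
      rw [ge_iff_le, div_le_div_iff₀ (by norm_num) hρ0]; nlinarith
    linarith
  have hac : a * c < ρ ^ (k + j + 2) := by
    calc a * c < ρ ^ (k + 1) * ρ ^ (j + 1) := mul_lt_mul'' hak hcj' (by linarith) (by linarith)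
      _ = ρ ^ (k + j + 2) := by rw [← pow_add]; ring_nf
  have hρkj : (6 : ℝ) / ρ ^ 2 < ρ ^ (k + j) := by
    rw [div_lt_iff₀ (by positivity), ← pow_add]
    calc (6 : ℝ) = 2 * 3 := by norm_num
      _ ≤ a * c := mul_le_mul ha2 hc3 (by norm_num) (by linarith)
      _ < ρ ^ (k + j + 2) := hac
  have hρkj2 : (2 : ℝ) ≤ ρ ^ (k + j) := by
    have hρsq : ρ ^ 2 ≤ 36 / 25 := by nlinarith
    have : (6 : ℝ) / ρ ^ 2 ≥ 6 / (36 / 25) := by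
      rw [ge_iff_le]; exact div_le_div_of_nonneg_left (by norm_num) (by positivity) hρsq
    linarith
  -- `M`, `N` as reals
  set M : ℕ := ⌈ρ ^ i⌉₊ - 1 with hM
  set N : ℕ := ⌈ρ ^ (k + j)⌉₊ - 1 with hN
  have hMreal : (M : ℝ) = ⌈ρ ^ i⌉₊ - 1 := by
    have h1 : 1 ≤ ⌈ρ ^ i⌉₊ := Nat.one_le_ceil_iff.mpr (by linarith)
    rw [hM, Nat.cast_sub h1, Nat.cast_one]
  have hNreal : (N : ℝ) = ⌈ρ ^ (k + j)⌉₊ - 1 := by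
    have h1 : 1 ≤ ⌈ρ ^ (k + j)⌉₊ := Nat.one_le_ceil_iff.mpr (by linarith)
    rw [hN, Nat.cast_sub h1, Nat.cast_one]
  have hMlt : (M : ℝ) < ρ ^ i := by
    rw [hMreal]; linarith [Nat.ceil_lt_add_one (show (0 : ℝ) ≤ ρ ^ i by positivity)]
  have hMge : ρ ^ i - 1 ≤ (M : ℝ) := by rw [hMreal]; linarith [Nat.le_ceil (ρ ^ i)]
  have hNlt : (N : ℝ) < ρ ^ (k + j) := by
    rw [hNreal]; linarith [Nat.ceil_lt_add_one (show (0 : ℝ) ≤ ρ ^ (k + j) by positivity)]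
  have hNge : ρ ^ (k + j) - 1 ≤ (N : ℝ) := by rw [hNreal]; linarith [Nat.le_ceil (ρ ^ (k + j))]
  have hM0 : (0 : ℝ) ≤ M := by linarith
  have hN0 : (0 : ℝ) ≤ N := by linarith
  have hpow3 : ρ ^ (k + i + j + 3) = ρ ^ i * ρ ^ (k + j) * ρ ^ 3 := by
    rw [← pow_add, ← pow_add]; ring_nf
  refine ⟨?_, ?_, ?_, ?_, hρi2, hρkj2⟩
  · -- `x^{1/3-δ} ≤ x^{1/3}/ρ - 1 < Y/ρ - 1 < ρ^i - 1 ≤ M`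
    have : (x : ℝ) ^ (1 / 3 : ℝ) / ρ < ρ ^ i :=
      lt_of_le_of_lt (div_le_div_of_nonneg_right hYx.le hρ0.le) hρi
    linarith
  · -- `M < ρ^i ≤ m₀ ≤ x^{1/2}` since `2 m₀² ≤ a m₀ c < ρ^{k+i+j+3} ≤ x + 2 ≤ 2x`
    have hm₀c : m₀ ≤ c := by
      have h2 : ρ ^ (i + 1) ≤ ρ ^ j := pow_le_pow_right₀ hρ.le (by omega)
      linarith
    have hm00 : 0 ≤ m₀ := by linarith
    have hprod : a * m₀ * c < (x : ℝ) + 2 := by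
      calc a * m₀ * c < ρ ^ (k + 1) * ρ ^ (i + 1) * ρ ^ (j + 1) :=
            mul_lt_mul'' (mul_lt_mul'' hak hm₀i' (by linarith) hm00) hcj' (by positivity)
              (by linarith)
        _ = ρ ^ (k + i + j + 3) := by rw [← pow_add, ← pow_add]; ring_nf
        _ ≤ (x : ℝ) + 2 := htop
    have hx2' : (2 : ℝ) ≤ x := by exact_mod_cast hx2
    have hsq : m₀ * m₀ ≤ x := by
      have h1 : 2 * (m₀ * m₀) ≤ a * m₀ * c := by
        calc 2 * (m₀ * m₀) = 2 * m₀ * m₀ := by ring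
          _ ≤ a * m₀ * c := by gcongr
      linarith
    have hm₀x : m₀ ≤ (x : ℝ) ^ (1 / 2 : ℝ) := by
      rw [← Real.sqrt_eq_rpow, Real.le_sqrt hm00 hx0.le, sq]
      exact hsq
    linarith [hMlt, hm₀i]
  · have h1 : ρ ^ i / 2 ≤ (M : ℝ) := by linarith
    have h2 : ρ ^ (k + j) / 2 ≤ (N : ℝ) := by linarith
    have h3 : ρ ^ i / 2 * (ρ ^ (k + j) / 2) ≤ (M : ℝ) * N :=
      mul_le_mul h1 h2 (by positivity) hM0
    have h4 : 8 * (x : ℝ) ^ (1 - δ) < ρ ^ i * ρ ^ (k + j) * ρ ^ 3 := by rw [← hpow3]; exact hbot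
    have hρsq : ρ ^ 2 ≤ 36 / 25 := by nlinarith
    have hρ3 : ρ ^ 3 ≤ 2 := by
      calc ρ ^ 3 = ρ * ρ ^ 2 := by ring
        _ ≤ 6 / 5 * (36 / 25) := mul_le_mul hρ2 hρsq (by positivity) (by norm_num)
        _ ≤ 2 := by norm_num
    have h5 : 0 ≤ ρ ^ i * ρ ^ (k + j) := by positivity
    have h6 : ρ ^ i * ρ ^ (k + j) * ρ ^ 3 ≤ ρ ^ i * ρ ^ (k + j) * 2 :=
      mul_le_mul_of_nonneg_left hρ3 h5
    have h7 : ρ ^ i / 2 * (ρ ^ (k + j) / 2) = ρ ^ i * ρ ^ (k + j) / 4 := by ring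
    rw [h7] at h3
    linarith
  · have h1 : (M : ℝ) * N ≤ ρ ^ i * ρ ^ (k + j) :=
      mul_le_mul hMlt.le hNlt.le hN0 (by positivity)
    have h2 : ρ ^ i * ρ ^ (k + j) * ρ ^ 3 ≤ (x : ℝ) + 2 := by rw [← hpow3]; exact htop
    have h5 : 0 ≤ ρ ^ i * ρ ^ (k + j) := by positivity
    -- `P ρ³ ≤ x + 2 ≤ ρ³ x`, so `P ≤ x`
    have hρ30 : 0 < ρ ^ 3 := by positivity
    have h3 : ρ ^ i * ρ ^ (k + j) * ρ ^ 3 ≤ x * ρ ^ 3 := by linarith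
    have h4 : ρ ^ i * ρ ^ (k + j) ≤ x := le_of_mul_le_mul_right h3 hρ30
    linarith

end Summit.Parity.GeneralizedHardyLittlewood.Theorems
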